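import Summits.Ventures.Crystal3D.Theorems.StickyWulffConstantTextureBuildLayerPropagation
import Summits.Ventures.Crystal3D.Theorems.StickyWulffConstantTextureLiminfCubeRigidity
import HarnessLib

/-!
# TB-1 brick L-PROP (frame form): additive layer propagation FOR A LABELLED PACKING — from a complete chart, along its own frame, toward the wall
# (lane T, crux `TextureLiminfV5`, stmt-Ventures-23912; memo HOME/wulff-p2/g25/SLAB-PLATES-g25.md §4)

HONEST FRAMING. Venture `Summits/Ventures/Crystal3D` (cell `crystal3d-full`), route `route-Ventures-StickyWulffConstant`, helper `--supports` the
law-v5 crux `TextureLiminfV5` (stmt-Ventures-23912).  Frame bookkeeping (census-free, standard axioms) over '…TextureBuildLayerPropagation'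
(`exists_local_stacking_slab`) in the style of `ballRigidity` ('…TextureLiminfCubeRigidity').  No cover is built; F-C1 not moved.

WHY.  '…TextureBuildLayerPropagation' proved the slab-local layer recursion in Hales's normalisation (unit BALLS, doubled coordinates, base layer at the
origin).  The constructor of the healed `stub_TB_cover` holds a labelled unit packing `x : Fin N → E3` and a COMPLETE CHART `stacking L b σ` around a
ball `b` ('…TextureBuildLocalCharts'), and wants to read the presentation of the same grain toward a wall, layer by layer in the chart's OWN frame `L`,
asking for close-packed shells only in the slab-cone it reads.  This file is that transfer:

* `haggLabel_shift`, `barlowPos_sub_barlowPos_shift`, **`stacking_rebase`** — re-basing a moved Barlow stacking at any of its sites `p`: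
  `stacking L s σ = stacking L p σ'` with `σ' = σ(· + k₀)` (so every chart can be centred at a ball);
* **`slabPropagation`** — `x` a unit packing; `stacking L b σ` carries every ball within `r` of `b` and is complete within `r` of `b` (`n + 1 ≤ r`);
  close-packed shells are asked only at the balls `x c` whose chart coordinates `v = L⁻¹(x c − b)` satisfy `|v₃ − m√(2/3)| ≤ 1`, `‖v‖ ≤ n − |m| + 1` for
  some level `|m| ≤ K₀`.  Then for a Hägg word `s` every site `L (barlowPos 1 √(2/3) s k i j) + b` with `|k| ≤ K₀ + 1`, `|i| + |j| ≤ n − 2|k|` IS A BALL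
  of `x` — the grain's presentation `stacking L b s`, same frame `L`, same origin `b`, letters read off the packing, certified on the cone down to one layer
  short of the first non-close-packed shell.
-/

noncomputable section

namespace Summit.Ventures.Crystal3D.Theorems

open Literature.Geometry.DiscreteGeometry Literature.MathematicalPhysics.StatisticalMechanics
open RealInnerProductSpace Summit.Ventures.Crystal3D.L2B Summit.Ventures.Crystal3D.Theorems.LocalStacking
open Summit.Ventures.Crystal3D.Cruxes.TextureLiminf.TexShadow (stacking)

variable {N : ℕ}

/-! ## Re-basing a moved stacking at one of its sites -/

section Rebase

/-- Shifting the Hägg word shifts the labels: `label_{s(·+k₀)}(m) = label_s(m + k₀) − label_s(k₀)`. -/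
theorem haggLabel_shift (s : ℤ → ℤ) (k₀ m : ℤ) : haggLabel (fun t => s (t + k₀)) m = haggLabel s (m + k₀) - haggLabel s k₀ := by
  induction m using Int.induction_on with
  | zero => simp
  | succ n ih =>
    rw [haggLabel_succ, ih, show (n : ℤ) + 1 + k₀ = (n + k₀) + 1 by ring, haggLabel_succ]
    ring
  | pred n ih =>
    have h1 := haggLabel_succ (fun t => s (t + k₀)) (-(n : ℤ) - 1)
    have h2 := haggLabel_succ s (-(n : ℤ) - 1 + k₀)
    rw [show -(n : ℤ) - 1 + 1 = -n by ring] at h1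
    rw [show -(n : ℤ) - 1 + k₀ + 1 = -n + k₀ by ring] at h2
    have h1' : haggLabel (fun t => s (t + k₀)) (-(n : ℤ)) = haggLabel (fun t => s (t + k₀)) (-(n : ℤ) - 1) + s (-(n : ℤ) - 1 + k₀) := h1
    linarith

/-- The difference of two sites is a site of the re-based word. -/
theorem barlowPos_sub_barlowPos_shift (a h : ℝ) (s : ℤ → ℤ) (k₀ i₀ j₀ k i j : ℤ) :
    barlowPos a h s k i j - barlowPos a h s k₀ i₀ j₀ = barlowPos a h (fun t => s (t + k₀)) (k - k₀) (i - i₀) (j - j₀) := by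
  simp only [barlowPos, haggLabel_shift, sub_add_cancel]
  push_cast
  module

/-- A shifted Hägg word is a Hägg word. -/
theorem isHaggSeq_shift {σ : ℤ → ℤ} (hσ : IsHaggSeq σ) (k₀ : ℤ) : IsHaggSeq (fun t => σ (t + k₀)) := fun t => hσ (t + k₀)

/-- **RE-BASING**: a moved Barlow stacking is the moved stacking, with the same frame, based at ANY of its sites (word shifted). -/
theorem stacking_rebase {L : EuclideanSpace ℝ (Fin 3) ≃ₗᵢ[ℝ] EuclideanSpace ℝ (Fin 3)} {sv p : EuclideanSpace ℝ (Fin 3)} {σ : ℤ → ℤ}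
    (hp : p ∈ stacking L sv σ) : ∃ k₀ : ℤ, stacking L sv σ = stacking L p (fun t => σ (t + k₀)) := by
  obtain ⟨r₀, ⟨k₀, i₀, j₀, rfl⟩, rfl⟩ := hp
  refine ⟨k₀, ?_⟩
  ext w
  constructor
  · rintro ⟨r, ⟨k, i, j, rfl⟩, rfl⟩
    refine ⟨barlowPos 1 (Real.sqrt (2 / 3)) (fun t => σ (t + k₀)) (k - k₀) (i - i₀) (j - j₀), ⟨_, _, _, rfl⟩, ?_⟩
    show L (barlowPos 1 (Real.sqrt (2 / 3)) (fun t => σ (t + k₀)) (k - k₀) (i - i₀) (j - j₀)) +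
        (L (barlowPos 1 (Real.sqrt (2 / 3)) σ k₀ i₀ j₀) + sv) = L (barlowPos 1 (Real.sqrt (2 / 3)) σ k i j) + sv
    rw [← barlowPos_sub_barlowPos_shift, map_sub]
    abel
  · rintro ⟨r, ⟨k, i, j, rfl⟩, rfl⟩
    refine ⟨barlowPos 1 (Real.sqrt (2 / 3)) σ (k + k₀) (i + i₀) (j + j₀), ⟨_, _, _, rfl⟩, ?_⟩
    show L (barlowPos 1 (Real.sqrt (2 / 3)) σ (k + k₀) (i + i₀) (j + j₀)) + sv =
        L (barlowPos 1 (Real.sqrt (2 / 3)) (fun t => σ (t + k₀)) k i j) + (L (barlowPos 1 (Real.sqrt (2 / 3)) σ k₀ i₀ j₀) + sv)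
    have h := barlowPos_sub_barlowPos_shift 1 (Real.sqrt (2 / 3)) σ k₀ i₀ j₀ (k + k₀) (i + i₀) (j + j₀)
    simp only [add_sub_cancel_right] at h
    rw [← h, map_sub]
    abel

end Rebase

/-! ## The slab propagation for a labelled packing -/

section Slab

variable {x : Fin N → EuclideanSpace ℝ (Fin 3)}

/-- Layer `0` of the doubled normalised stacking is the standard lattice. -/
theorem barlowPos_two_zero_eq_latPt (σ : ℤ → ℤ) (i j : ℤ) : barlowPos 2 layerSpacing σ 0 i j = latPt i j := by
  rw [barlowPos_eq_latPt]; simp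

/-- `‖barlowPos 1 √(2/3) s k i j‖ = ½ ‖barlowPos 2 h s k i j‖`. -/
theorem norm_barlowPos_one (s : ℤ → ℤ) (k i j : ℤ) :
    ‖barlowPos 1 (Real.sqrt (2 / 3)) s k i j‖ = ‖barlowPos 2 layerSpacing s k i j‖ / 2 := by
  rw [barlowPos_two_eq_two_smul, norm_smul, Real.norm_of_nonneg zero_le_two]; ring

/-- **SLAB PROPAGATION FOR A LABELLED PACKING.**  See the module docstring. -/
theorem slabPropagation (hx : IsUnitPacking x) {L : EuclideanSpace ℝ (Fin 3) ≃ₗᵢ[ℝ] EuclideanSpace ℝ (Fin 3)}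
    {b : EuclideanSpace ℝ (Fin 3)} {σ : ℤ → ℤ} (hσ : IsHaggSeq σ) {n : ℤ} {r : ℝ} (hnr : (n : ℝ) + 1 ≤ r)
    (hcarry : ∀ c, dist (x c) b ≤ r → x c ∈ stacking L b σ)
    (hcomp : ∀ w ∈ stacking L b σ, dist w b ≤ r → w ∈ Set.range x)
    (K₀ : ℕ)
    (hcp : ∀ c : Fin N, ∀ m : ℤ, |m| ≤ K₀ → |(L.symm (x c - b)) 2 - m * Real.sqrt (2 / 3)| ≤ 1 →
      ‖L.symm (x c - b)‖ ≤ n - |m| + 1 → IsClosePackedShell x c) :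
    ∃ s : ℤ → ℤ, IsHaggSeq s ∧ ∀ k i j : ℤ, |k| ≤ K₀ + 1 → |i| + |j| ≤ n - 2 * |k| →
      L (barlowPos 1 (Real.sqrt (2 / 3)) s k i j) + b ∈ Set.range x := by
  set V : Set (EuclideanSpace ℝ (Fin 3)) := Set.range fun j => (2 : ℝ) • x j with hVdef
  have hV : IsUnitBallPacking V := isUnitBallPacking_range_two_smul hx
  set W : Set (EuclideanSpace ℝ (Fin 3)) := {y | (2 : ℝ) • b + L y ∈ V} with hWdef
  have hW : IsUnitBallPacking W := hV.preimage ((2 : ℝ) • b) L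
  -- membership in `W`
  have memW : ∀ y, y ∈ W ↔ ∃ c, (2 : ℝ) • x c = (2 : ℝ) • b + L y := fun y => by
    simp only [hWdef, hVdef, Set.mem_setOf_eq, Set.mem_range]
  -- the half point of a `W`-point
  have halfW : ∀ {y : EuclideanSpace ℝ (Fin 3)} {c : Fin N}, (2 : ℝ) • x c = (2 : ℝ) • b + L y →
      x c - b = L ((2 : ℝ)⁻¹ • y) := by
    intro y c h
    have h2 : (2 : ℝ) • (x c - b) = L y := by rw [smul_sub, h]; abel
    rw [map_smul, ← h2, smul_smul]; norm_num
  have halfW' : ∀ {y : EuclideanSpace ℝ (Fin 3)} {c : Fin N}, (2 : ℝ) • x c = (2 : ℝ) • b + L y →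
      L.symm (x c - b) = (2 : ℝ)⁻¹ • y := by
    intro y c h; rw [halfW h, LinearIsometryEquiv.symm_apply_apply]
  have distW : ∀ {y : EuclideanSpace ℝ (Fin 3)} {c : Fin N}, (2 : ℝ) • x c = (2 : ℝ) • b + L y → dist (x c) b = ‖y‖ / 2 := by
    intro y c h
    rw [dist_eq_norm, halfW h, LinearIsometryEquiv.norm_map, norm_smul, Real.norm_of_nonneg (by norm_num)]; ring
  -- (A) sites of the chart within `r` are `W`-points (doubled)
  have siteW : ∀ k i j : ℤ, ‖barlowPos 1 (Real.sqrt (2 / 3)) σ k i j‖ ≤ r → barlowPos 2 layerSpacing σ k i j ∈ W := by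
    intro k i j hq
    set q := barlowPos 1 (Real.sqrt (2 / 3)) σ k i j with hqdef
    have hmem : L q + b ∈ stacking L b σ := ⟨q, ⟨k, i, j, rfl⟩, rfl⟩
    have hd : dist (L q + b) b ≤ r := by rwa [dist_eq_norm, add_sub_cancel_right, LinearIsometryEquiv.norm_map]
    obtain ⟨c, hc⟩ := hcomp _ hmem hd
    refine (memW _).2 ⟨c, ?_⟩
    rw [hc, barlowPos_two_eq_two_smul, map_smul, smul_add]
    abel
  -- (B) `W`-points within `2r` are doubled sites of the chart
  have pointB : ∀ y ∈ W, ‖y‖ ≤ 2 * r → y ∈ barlowStacking 2 layerSpacing σ := by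
    intro y hy hyn
    obtain ⟨c, hc⟩ := (memW y).1 hy
    have hd : dist (x c) b ≤ r := by rw [distW hc]; linarith
    obtain ⟨q, hq, hcq⟩ := hcarry c hd
    have hyq : y = (2 : ℝ) • q := by
      have hcq' : L q + b = x c := hcq
      have h1 : x c - b = L q := by rw [← hcq', add_sub_cancel_right]
      rw [halfW hc] at h1
      have h2 := L.injective h1
      rw [← h2, smul_smul]; norm_num
    rw [hyq]
    exact (Summit.Ventures.Crystal3D.mem_barlowStacking_one_iff σ q).1 hq
  -- the base layer datum
  have hσ0 : ((σ 0 : ℤ) : ℝ) = 1 ∨ ((σ 0 : ℤ) : ℝ) = -1 := by rcases hσ 0 with h | h <;> simp [h]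
  have hσ1 : (-((σ (-1) : ℤ) : ℝ)) = 1 ∨ (-((σ (-1) : ℤ) : ℝ)) = -1 := by rcases hσ (-1) with h | h <;> simp [h]
  have hLD : LayerDisc W 0 ((σ 0 : ℤ) : ℝ) (-((σ (-1) : ℤ) : ℝ)) n := by
    intro i j hij
    have hij' : ((|i| + |j| : ℤ) : ℝ) ≤ n := by exact_mod_cast hij
    have hnorm2 : ‖barlowPos 2 layerSpacing σ 0 i j‖ ≤ 2 * n := by
      rw [barlowPos_two_zero_eq_latPt]; linarith [norm_latPt_le i j]
    have hnorm1 : ‖barlowPos 1 (Real.sqrt (2 / 3)) σ 0 i j‖ ≤ r := by rw [norm_barlowPos_one]; linarith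
    rw [zero_add, ← barlowPos_two_zero_eq_latPt σ]
    refine ⟨siteW 0 i j hnorm1, ?_⟩
    have hshell0 := kissingShell_barlowStacking_eq_layerShell hσ 0 i j
    rw [show (0 : ℤ) - 1 = -1 from by norm_num] at hshell0
    rw [← hshell0]
    ext y
    simp only [mem_kissingShell_iff]
    constructor
    · rintro ⟨hyW, hy2⟩
      refine ⟨pointB _ hyW ?_, hy2⟩
      calc ‖barlowPos 2 layerSpacing σ 0 i j + y‖ ≤ ‖barlowPos 2 layerSpacing σ 0 i j‖ + ‖y‖ := norm_add_le _ _
        _ ≤ 2 * n + 2 := by rw [hy2]; linarith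
        _ ≤ 2 * r := by linarith
    · rintro ⟨hyB, hy2⟩
      refine ⟨?_, hy2⟩
      obtain ⟨k', i', j', hk'⟩ := hyB
      have hnorm' : ‖barlowPos 1 (Real.sqrt (2 / 3)) σ k' i' j'‖ ≤ r := by
        rw [norm_barlowPos_one, ← hk']
        calc ‖barlowPos 2 layerSpacing σ 0 i j + y‖ / 2 ≤ (‖barlowPos 2 layerSpacing σ 0 i j‖ + ‖y‖) / 2 := by
              gcongr; exact norm_add_le _ _
          _ ≤ (2 * n + 2) / 2 := by rw [hy2]; linarith
          _ ≤ r := by linarith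
      rw [hk']
      exact siteW k' i' j' hnorm'
  -- the slab-cone hypothesis in the frame
  have hcpW : ∀ u ∈ W, ∀ m : ℤ, |m| ≤ K₀ → |u 2 - m * layerSpacing| ≤ 2 → ‖u‖ ≤ 2 * n - 2 * |m| + 2 →
      IsArrangedIn (kissingShell W u) fccKissingPattern ∨ IsArrangedIn (kissingShell W u) hcpKissingPattern := by
    intro u hu m hm hu2 hun
    obtain ⟨c, hc⟩ := (memW u).1 hu
    have hshell : kissingShell W u = L ⁻¹' kissingShell V ((2 : ℝ) • x c) := by
      rw [hWdef, kissingShell_moved, ← hc]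
    have hcp' : IsClosePackedShell x c := by
      refine hcp c m hm ?_ ?_
      · rw [halfW' hc, PiLp.smul_apply, smul_eq_mul]
        have e : (2 : ℝ)⁻¹ * u 2 - m * Real.sqrt (2 / 3) = (2 : ℝ)⁻¹ * (u 2 - m * layerSpacing) := by
          rw [layerSpacing]; ring
        rw [e, abs_mul, abs_of_pos (by norm_num : (0 : ℝ) < 2⁻¹)]
        linarith
      · rw [halfW' hc, norm_smul, Real.norm_of_nonneg (by norm_num)]
        have : ((|m| : ℤ) : ℝ) = |(m : ℝ)| := by push_cast; rfl
        linarith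
    rw [hshell, hVdef, kissingShell_range_two_smul]
    exact hcp'.imp (fun h => h.preimage L) (fun h => h.preimage L)
  -- run the recursion and undo the frame
  obtain ⟨s, hs, hcone⟩ := exists_local_stacking_slab hW hσ0 hσ1 hLD K₀ hcpW
  refine ⟨s, hs, fun k i j hk hij => ?_⟩
  obtain ⟨c, hc⟩ := (memW _).1 (hcone k i j hk hij)
  refine ⟨c, ?_⟩
  have h := halfW hc
  rw [barlowPos_two_eq_two_smul, smul_smul, inv_mul_cancel₀ (two_ne_zero' ℝ), one_smul] at h
  rw [← h]
  abel

end Slab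

end Summit.Ventures.Crystal3D.Theorems

end
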